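import Summits.NavierStokesRegularity.NavierStokesRegularity.Theorems.CoriolisHeadLocalEnergyCylinder
import Summits.NavierStokesRegularity.NavierStokesRegularity.Theorems.CoriolisHeadLocalEnergyPressureIdentification
import Summits.NavierStokesRegularity.NavierStokesRegularity.Theorems.CoriolisHeadLocalEnergyRieszPressureDensity
import Literature.Analysis.FluidPDE.ClassicalSuitableRegion
import HarnessLib

/-!
# CoriolisHeadLocalEnergyClass — crux `NoCoRotatingCore` (stmt-NavierStokesRegularity-22676), line `local_energy_rescue`
# v2.1 (crux workfile `Cruxes/NoCoRotatingCore/Lines/local_energy_rescue.lean`, ns-idea-10 g3; NOT the registered skeleton):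
# **stub S3a `stub_localEnergyClass` proved, statement verbatim** (seat ns-ffc-k1 g3, helper; closing file)

S3a: a bounded smooth rotated Leray profile `(U, P)` (ANY `ν, a > 0`, ANY skew `B`) with `BMO₂` pressure
(`∫_{B(z,ρ)}(P − m)² ≤ Kρ³`) and sub-volume energy density (`∫_{B(z,ρ)}‖U‖² ≤ K₂ρ^{3−β}`, `β > 1`, `ρ ≥ 1`) has
(i) LINEAR energy density `∫_{B(z,ρ)}‖U‖² ≤ K₃ρ`, and (ii) its PHYSICAL rotated self-similar field `u` (blow-up time `0`)
lies, with some pressure `p`, in Caffarelli–Kohn–Nirenberg's class on `Q₁(0,0)` in exactly the hypothesis structure of the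
tree fact `tsai1998_top_singular_null`: suitable weak solution, `sup_t ∫_{B₁}|u|² < ∞`, weak gradient in `L²(Q₁)`,
`p ∈ L^{3/2}(Q₁)`.

PROOF (files `…PhysicalField`, `…PhysicalSlices`, `…LinearDensity`, `…PressureGauge`, `…Cylinder`).
* All-radii bookkeeping (`exists_allRadii_bounds`): density `Aρ^γ` and gauged pressure flux `J₀ρ^γ` for ALL `ρ > 0` with
  `γ = 3 − min(β,3) < 2`, from the hypotheses for `ρ ≥ 1` (pressure: identification `P = Q̃ + c`, H1
  `pressure_eq_pressurePotentialMod_add_const`, and the Calderón–Zygmund round H2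
  `exists_sq_oscillation_pressurePotentialMod_le_of_density`) and the trivial bounds below `ρ = 1`.
* (i): ONE physical local-energy round with the dissipation kept (`linearDensity_of_subVolume`).
* (ii): with (i), H1 + H2 at `β = 2` give `∫_{B(0,ρ)}(P − m_ρ)² ≤ K₁ρ`, hence a CONSTANT gauge `m_∞`
  (`exists_const_gauge_of_sq_oscillation`); `P − m_∞` is again a profile pressure, so the physical field with the pressure
  `p(t) = λ²(P − m_∞)(λe^{−θB}·)` is a CLASSICAL solution on `(−∞,0)` (`isClassicalNSSolutionOn_physicalField`), hence
  suitable on `Q₁(0,0)` with weak gradient `∇u` (tree `IsClassicalNSSolutionOnRegion.isSuitableWeakSolutionOn_of_subset`,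
  `….hasWeakSpatialGradientOn`); `henergy` from (i) by the slices, `hgrad` from `dissipation_bound` +
  `lintegral_cylinder_gradient_le`, `hp` from Hölder on balls + `lintegral_cylinder_pressure_le`.

HONEST FRAMING.  A helper for an UNREGISTERED line (no stub credit claimed).  With S1 (p639741), S2 (p633214), S3b (p629470)
landed, the rescue line's analytic stubs are now ALL in the tree; what remains of that line is its declared residual R1 =
Pineau–Vicol's Conjecture 1.1 AS PRINTED (an open problem).  Nothing here proves `NoCoRotatingCore`, Conjecture 1.1, K1a
of line `far_field_constancy`, or NS regularity.

References: L. Caffarelli, R. Kohn, L. Nirenberg, CPAM 35 (1982) §2 [CaffarelliKohnNirenberg1982]; T.-P. Tsai, ARMA 143 (1998)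
Lemma 4.1, Cor. 4.3 [Tsai1998]; D. Chae, J. Wolf, arXiv:1610.09464 §2 [ChaeWolf2017RemovingDSS]; line card
`Lines/local_energy_rescue.md` (S3a).
-/

noncomputable section

open MeasureTheory Set Function Filter Topology Metric InnerProductSpace Real
open scoped RealInnerProductSpace Laplacian ContDiff Topology ENNReal NNReal

-- the summit and its single sub-problem share the name (CONVENTIONS §1), as in every Theorems file
set_option linter.dupNamespace false
-- nested operator types `ℝ³ →L[ℝ] ℝ³` inside the Banach algebra `ℝ³ →L[ℝ] ℝ³` (as in `CoriolisHeadTypeIRateTransport`)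
set_option maxSynthPendingDepth 3

namespace Summit.NavierStokesRegularity.NavierStokesRegularity.Theorems.CoriolisHead

namespace LocalEnergyRescue

open Literature.Analysis.FluidPDE

section Bookkeeping

variable {ν a : ℝ} {B : EuclideanSpace ℝ (Fin 3) →L[ℝ] EuclideanSpace ℝ (Fin 3)}
  {U : EuclideanSpace ℝ (Fin 3) → EuclideanSpace ℝ (Fin 3)} {P : EuclideanSpace ℝ (Fin 3) → ℝ}

/-! ## §1 Density and pressure flux at all radii -/

/-- **All-radii bookkeeping.**  A bounded smooth rotated profile with `BMO₂` pressure (`Kρ³`) and sub-volume density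
`K₂ρ^{3−β}` (`ρ ≥ 1`, `β > 1`) has, with `γ = 3 − min(β,3) < 2`, density `∫_{B(z,ρ)}‖U‖² ≤ Aρ^γ` and a gauged
pressure flux `∫_{B(z,ρ)}|P − m|‖U‖ ≤ J₀ρ^γ` at EVERY radius `ρ > 0`: for `ρ ≥ 1` the pressure oscillation is
`≤ κ(M²K₂ + K₂²)ρ^γ` by the identification `P = Q̃ + c` (H1) and the Calderón–Zygmund round (H2); below `ρ = 1` the
trivial bounds `M²|B₁|ρ³`, `Kρ³` are `≤ ρ^γ`; the flux by `ab ≤ (a² + b²)/2`. [cite: CaffarelliKohnNirenberg1982, §2 (2.5)] -/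
theorem exists_allRadii_bounds (hν : 0 < ν) (ha : 0 < a) (hU : ContDiff ℝ ∞ U) (hP : ContDiff ℝ 2 P)
    (hB : ∀ x, inner ℝ (B x) x = 0) (hdiv : VectorCalculus.IsDivFree U)
    (heq : ∀ y, -(ν • (Δ U) y) + a • U y + a • fderiv ℝ U y y + (B (U y) - fderiv ℝ U y (B y)) +
      convect U U y + gradient P y = 0)
    {M : ℝ} (hM : ∀ y, ‖U y‖ ≤ M) {K : ℝ}
    (hbmo : ∀ (z : EuclideanSpace ℝ (Fin 3)) (ρ : ℝ), 0 < ρ → ∃ m : ℝ, ∫ y in ball z ρ, (P y - m) ^ 2 ≤ K * ρ ^ 3)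
    {β K₂ : ℝ} (hβ : 1 < β)
    (hdens : ∀ (z : EuclideanSpace ℝ (Fin 3)) (ρ : ℝ), 1 ≤ ρ → ∫ y in ball z ρ, ‖U y‖ ^ 2 ≤ K₂ * ρ ^ (3 - β)) :
    ∃ A J₀ γ : ℝ, γ < 2 ∧
      (∀ (z : EuclideanSpace ℝ (Fin 3)) (ρ : ℝ), 0 < ρ → ∫ y in ball z ρ, ‖U y‖ ^ 2 ≤ A * ρ ^ γ) ∧
      (∀ (z : EuclideanSpace ℝ (Fin 3)) (ρ : ℝ), 0 < ρ →
        ∃ m : ℝ, ∫ y in ball z ρ, |P y - m| * ‖U y‖ ≤ J₀ * ρ ^ γ) := by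
  have hUc : Continuous U := hU.continuous
  have hPc : Continuous P := hP.continuous
  have hM0 : 0 ≤ M := (norm_nonneg _).trans (hM 0)
  set β' : ℝ := min β 3 with hβ'
  set γ : ℝ := 3 - β' with hγ
  have hβ'1 : 1 < β' := lt_min hβ (by norm_num)
  have hβ'3 : β' ≤ 3 := min_le_right _ _
  have hβ'β : β' ≤ β := min_le_left _ _
  have hγ2 : γ < 2 := by rw [hγ]; linarith
  have hγ3 : γ ≤ 3 := by rw [hγ]; linarith
  have hK₂0 : 0 ≤ K₂ := by
    have h := hdens 0 1 le_rfl
    have h0 : 0 ≤ ∫ y in ball (0 : EuclideanSpace ℝ (Fin 3)) 1, ‖U y‖ ^ 2 := integral_nonneg fun y => by positivity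
    rw [Real.one_rpow, mul_one] at h
    linarith
  have hK0 : 0 ≤ K := by
    obtain ⟨m, hm⟩ := hbmo 0 1 one_pos
    have h0 : 0 ≤ ∫ y in ball (0 : EuclideanSpace ℝ (Fin 3)) 1, (P y - m) ^ 2 := integral_nonneg fun y => sq_nonneg _
    linarith
  -- density for `ρ ≥ 1` with the exponent `γ`
  have hdens' : ∀ (z : EuclideanSpace ℝ (Fin 3)) (ρ : ℝ), 1 ≤ ρ → ∫ y in ball z ρ, ‖U y‖ ^ 2 ≤ K₂ * ρ ^ (3 - β') :=
    fun z ρ hρ => (hdens z ρ hρ).trans (mul_le_mul_of_nonneg_left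
      (Real.rpow_le_rpow_of_exponent_le hρ (by linarith)) hK₂0)
  -- small radii: `ρ³ ≤ ρ^γ`
  have hsmall : ∀ ρ : ℝ, 0 < ρ → ρ < 1 → ρ ^ 3 ≤ ρ ^ γ := fun ρ hρ hρ1 => by
    have h := Real.rpow_le_rpow_of_exponent_ge hρ hρ1.le hγ3
    rwa [show ρ ^ (3 : ℝ) = ρ ^ 3 by norm_cast] at h
  set W : ℝ := (volume (ball (0 : EuclideanSpace ℝ (Fin 3)) 1)).toReal with hW
  have hW0 : 0 ≤ W := ENNReal.toReal_nonneg
  -- density at all radii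
  set A : ℝ := K₂ + M ^ 2 * W with hA
  have hI : ∀ (z : EuclideanSpace ℝ (Fin 3)) (ρ : ℝ), 0 < ρ → ∫ y in ball z ρ, ‖U y‖ ^ 2 ≤ A * ρ ^ γ := by
    intro z ρ hρ
    have hργ : 0 ≤ ρ ^ γ := Real.rpow_nonneg hρ.le _
    rcases le_or_gt 1 ρ with hρ1 | hρ1
    · have h := hdens' z ρ hρ1
      rw [hA]
      nlinarith [mul_nonneg (mul_nonneg (sq_nonneg M) hW0) hργ]
    · have h := setIntegral_ball_norm_sq_le_cube (V := U) hM z hρ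
      rw [← hW] at h
      have h2 : M ^ 2 * W * ρ ^ 3 ≤ M ^ 2 * W * ρ ^ γ := mul_le_mul_of_nonneg_left (hsmall ρ hρ hρ1) (by positivity)
      rw [hA]
      nlinarith [mul_nonneg hK₂0 hργ]
  -- pressure oscillation at all radii
  obtain ⟨c₀, hc₀⟩ := pressure_eq_pressurePotentialMod_add_const hν ha hU hP hB hdiv heq hM hbmo
  obtain ⟨κ, hκ0, hκ⟩ := exists_sq_oscillation_pressurePotentialMod_le_of_density
  have hQ := hκ U M hU hM K₂ β' (by linarith) hβ'3 hdens' 0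
  set KP : ℝ := κ * (M ^ 2 * K₂ + K₂ ^ 2) + K with hKP
  have hKP1 : 0 ≤ κ * (M ^ 2 * K₂ + K₂ ^ 2) := by positivity
  have hosc : ∀ (z : EuclideanSpace ℝ (Fin 3)) (ρ : ℝ), 0 < ρ →
      ∃ m : ℝ, ∫ y in ball z ρ, (P y - m) ^ 2 ≤ KP * ρ ^ γ := by
    intro z ρ hρ
    have hργ : 0 ≤ ρ ^ γ := Real.rpow_nonneg hρ.le _
    rcases le_or_gt 1 ρ with hρ1 | hρ1
    · obtain ⟨m, hm⟩ := hQ z ρ hρ1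
      refine ⟨m + c₀, ?_⟩
      have e : ∀ y, (P y - (m + c₀)) ^ 2 = (pressurePotentialMod 0 U y - m) ^ 2 := fun y => by rw [hc₀ y]; ring
      simp_rw [e]
      rw [hKP]
      nlinarith [mul_nonneg hK0 hργ]
    · obtain ⟨m, hm⟩ := hbmo z ρ hρ
      refine ⟨m, ?_⟩
      have h2 : K * ρ ^ 3 ≤ K * ρ ^ γ := mul_le_mul_of_nonneg_left (hsmall ρ hρ hρ1) hK0
      rw [hKP]
      nlinarith [mul_nonneg hKP1 hργ]
  -- the gauged pressure flux
  refine ⟨A, (KP + A) / 2, γ, hγ2, hI, fun z ρ hρ => ?_⟩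
  obtain ⟨m, hm⟩ := hosc z ρ hρ
  refine ⟨m, ?_⟩
  have h := setIntegral_abs_sub_mul_norm_le hPc hUc z ρ m one_pos
  have h2 := hI z ρ hρ
  have e : (KP + A) / 2 * ρ ^ γ = 1 / 2 * (KP * ρ ^ γ) + 1 / (2 * 1) * (A * ρ ^ γ) := by ring
  rw [e]
  nlinarith

/-- **Linear mean oscillation of the pressure after (i).**  With LINEAR energy density `∫_{B(z,ρ)}‖U‖² ≤ K₃ρ` (`ρ ≥ 1`),
the pressure has `∫_{B(0,ρ)}(P − m_ρ)² ≤ K₁ρ` for `ρ ≥ 1`: identification `P = Q̃ + c` (H1) and the Calderón–Zygmund round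
(H2) at `β = 2`. [cite: CaffarelliKohnNirenberg1982, §2 (2.5)] -/
theorem exists_linear_sq_oscillation (hν : 0 < ν) (ha : 0 < a) (hU : ContDiff ℝ ∞ U) (hP : ContDiff ℝ 2 P)
    (hB : ∀ x, inner ℝ (B x) x = 0) (hdiv : VectorCalculus.IsDivFree U)
    (heq : ∀ y, -(ν • (Δ U) y) + a • U y + a • fderiv ℝ U y y + (B (U y) - fderiv ℝ U y (B y)) +
      convect U U y + gradient P y = 0)
    {M : ℝ} (hM : ∀ y, ‖U y‖ ≤ M) {K : ℝ}
    (hbmo : ∀ (z : EuclideanSpace ℝ (Fin 3)) (ρ : ℝ), 0 < ρ → ∃ m : ℝ, ∫ y in ball z ρ, (P y - m) ^ 2 ≤ K * ρ ^ 3)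
    {K₃ : ℝ} (hK₃ : ∀ (z : EuclideanSpace ℝ (Fin 3)) (ρ : ℝ), 1 ≤ ρ → ∫ y in ball z ρ, ‖U y‖ ^ 2 ≤ K₃ * ρ) :
    ∃ K₁ : ℝ, ∀ ρ : ℝ, 1 ≤ ρ → ∃ m : ℝ, ∫ y in ball (0 : EuclideanSpace ℝ (Fin 3)) ρ, (P y - m) ^ 2 ≤ K₁ * ρ := by
  obtain ⟨c₀, hc₀⟩ := pressure_eq_pressurePotentialMod_add_const hν ha hU hP hB hdiv heq hM hbmo
  obtain ⟨κ, -, hκ⟩ := exists_sq_oscillation_pressurePotentialMod_le_of_density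
  have hdens2 : ∀ (z : EuclideanSpace ℝ (Fin 3)) (ρ : ℝ), 1 ≤ ρ → ∫ y in ball z ρ, ‖U y‖ ^ 2 ≤ K₃ * ρ ^ (3 - (2 : ℝ)) :=
    fun z ρ hρ => by rw [show (3 : ℝ) - 2 = 1 by norm_num, Real.rpow_one]; exact hK₃ z ρ hρ
  have hQ := hκ U M hU hM K₃ 2 (by norm_num) (by norm_num) hdens2 0 0
  refine ⟨κ * (M ^ 2 * K₃ + K₃ ^ 2), fun ρ hρ => ?_⟩
  obtain ⟨m, hm⟩ := hQ ρ hρ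
  refine ⟨m + c₀, ?_⟩
  have e : ∀ y, (P y - (m + c₀)) ^ 2 = (pressurePotentialMod 0 U y - m) ^ 2 := fun y => by rw [hc₀ y]; ring
  simp_rw [e]
  rwa [show (3 : ℝ) - 2 = 1 by norm_num, Real.rpow_one] at hm

end Bookkeeping

end LocalEnergyRescue

/-! ## §2 Stub S3a by name -/

open LocalEnergyRescue Literature.Analysis.FluidPDE in
/-- **stub S3a — `stub_localEnergyClass`** of the line `local_energy_rescue` v2.1 (crux `CoriolisHead.NoCoRotatingCore`,
item 22676; statement verbatim from the crux workfile `Lines/local_energy_rescue.lean`, with the skeleton's local notation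
`E3` spelled out as `EuclideanSpace ℝ (Fin 3)`): a bounded smooth rotated profile (ANY `ν, a > 0`, ANY skew `B`) with `BMO₂`
pressure and sub-volume energy density `β > 1` has (i) LINEAR energy density `∫_{B(z,ρ)}‖U‖² ≤ K₃ρ` (`ρ ≥ 1`), and (ii) its
physical rotated self-similar field (blow-up time `0`) lies, with the pressure `λ²(P − m_∞)(λe^{−θB}·)`, in the
Caffarelli–Kohn–Nirenberg class on `Q₁(0,0)` in the exact hypothesis structure of `tsai1998_top_singular_null`.  Proof: one
PHYSICAL local-energy round with the dissipation kept (the enstrophy is its dissipation term; no almost-monotonicity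
identity), a constant pressure gauge, and the classical ⇒ suitable bridge; see the module docstring.  The line is
unregistered: this is a helper, no stub credit is claimed; R1 (Pineau–Vicol Conj. 1.1 as printed), `NoCoRotatingCore` and
NS regularity are NOT proved here. [cite: CaffarelliKohnNirenberg1982, §2 (2.1)–(2.5); Tsai1998 Lemma 4.1 (p. 46)] -/
theorem stub_localEnergyClass :
    ∀ (ν a : ℝ), 0 < ν → 0 < a → ∀ (B : EuclideanSpace ℝ (Fin 3) →L[ℝ] EuclideanSpace ℝ (Fin 3))
      (U : EuclideanSpace ℝ (Fin 3) → EuclideanSpace ℝ (Fin 3)) (P : EuclideanSpace ℝ (Fin 3) → ℝ),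
      ContDiff ℝ (⊤ : ℕ∞) U → ContDiff ℝ 2 P → (∀ x, inner ℝ (B x) x = 0) →
      Literature.Analysis.FluidPDE.VectorCalculus.IsDivFree U →
      (∀ y, -(ν • Laplacian.laplacian U y) + a • U y + a • fderiv ℝ U y y
        + (B (U y) - fderiv ℝ U y (B y)) + Literature.Analysis.FluidPDE.convect U U y
        + gradient P y = 0) →
      (∃ M : ℝ, ∀ y, ‖U y‖ ≤ M) →
      ∀ K : ℝ,
      (∀ (z : EuclideanSpace ℝ (Fin 3)) (ρ : ℝ), 0 < ρ →
        ∃ m : ℝ, ∫ y in Metric.ball z ρ, (P y - m) ^ 2 ≤ K * ρ ^ 3) →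
      ∀ (β K₂ : ℝ), 1 < β →
      (∀ (z : EuclideanSpace ℝ (Fin 3)) (ρ : ℝ), 1 ≤ ρ →
        ∫ y in Metric.ball z ρ, ‖U y‖ ^ 2 ≤ K₂ * ρ ^ (3 - β)) →
      ∀ (u : ℝ → EuclideanSpace ℝ (Fin 3) → EuclideanSpace ℝ (Fin 3)),
      (∀ (t : ℝ) (x : EuclideanSpace ℝ (Fin 3)), u t x = (Real.sqrt (2 * a * (0 - t)))⁻¹ •
        (NormedSpace.exp ((a⁻¹ * Real.log (Real.sqrt (2 * a * (0 - t)))⁻¹) • B))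
          (U ((Real.sqrt (2 * a * (0 - t)))⁻¹ •
            (NormedSpace.exp ((-(a⁻¹ * Real.log (Real.sqrt (2 * a * (0 - t)))⁻¹)) • B)) x))) →
      (∃ K₃ : ℝ,
        (∀ (z : EuclideanSpace ℝ (Fin 3)) (ρ : ℝ), 1 ≤ ρ →
          ∫ y in Metric.ball z ρ, ‖U y‖ ^ 2 ≤ K₃ * ρ ^ (3 - 2))) ∧
      (∃ p : ℝ → EuclideanSpace ℝ (Fin 3) → ℝ,
        IsSuitableWeakSolutionOn (parabolicCylinderOpens 1 ((0 : ℝ), (0 : EuclideanSpace ℝ (Fin 3)))) ν 0 u p ∧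
        (∃ C : ℝ≥0, ∀ᵐ t : ℝ, t ∈ Set.Ioo ((0 : ℝ) - 1 ^ 2) 0 →
          ∫⁻ x in Metric.ball (0 : EuclideanSpace ℝ (Fin 3)) 1, ‖u t x‖ₑ ^ 2 ≤ C) ∧
        (∃ G : ℝ → EuclideanSpace ℝ (Fin 3) → EuclideanSpace ℝ (Fin 3) →L[ℝ] EuclideanSpace ℝ (Fin 3),
          HasWeakSpatialGradientOn (parabolicCylinderOpens 1 ((0 : ℝ), (0 : EuclideanSpace ℝ (Fin 3)))) u G ∧
          ∫⁻ z in parabolicCylinder 1 ((0 : ℝ), (0 : EuclideanSpace ℝ (Fin 3))),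
            ENNReal.ofReal (frobeniusNormSq (G z.1 z.2)) < ⊤) ∧
        (∫⁻ z in parabolicCylinder 1 ((0 : ℝ), (0 : EuclideanSpace ℝ (Fin 3))),
          ‖p z.1 z.2‖ₑ ^ (3 / 2 : ℝ) < ⊤)) := by
  intro ν a hν ha B U P hU hP hB hdiv heq hbdd K hbmo β K₂ hβ hdens u hu
  obtain ⟨M, hM⟩ := hbdd
  have hM0 : 0 ≤ M := (norm_nonneg _).trans (hM 0)
  have hUc : Continuous U := hU.continuous
  have hPc : Continuous P := hP.continuous
  set W : ℝ := (volume (ball (0 : EuclideanSpace ℝ (Fin 3)) 1)).toReal with hW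
  have hW0 : 0 ≤ W := ENNReal.toReal_nonneg
  -- all-radii bounds and the classical solution with the original pressure
  obtain ⟨A, J₀, γ, hγ2, hI, hJ⟩ := exists_allRadii_bounds hν ha hU hP hB hdiv heq hM hbmo hβ hdens
  have hNS₀ := isClassicalNSSolutionOn_physicalField hν ha hU (hP.of_le (by norm_num)) hB hdiv heq hu
  have hp₀ := fun (t : ℝ) (ht : t < 0) (x : EuclideanSpace ℝ (Fin 3)) => physicalPressure_apply (B := B) (P := P) ha ht x
  -- (i) linear density
  obtain ⟨K₃, hK₃0, hK₃⟩ := linearDensity_of_subVolume hν.le ha hB hu hNS₀ hp₀ hUc hM hγ2 hI hJ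
  refine ⟨⟨K₃, fun z ρ hρ => ?_⟩, ?_⟩
  · norm_num
    exact hK₃ z ρ hρ
  -- the constant gauge and the renormalised pressure
  obtain ⟨K₁, hK₁⟩ := exists_linear_sq_oscillation hν ha hU hP hB hdiv heq hM hbmo hK₃
  obtain ⟨mInf, hmInf⟩ := exists_const_gauge_of_sq_oscillation hPc hK₁
  have hK₁0 : 0 ≤ K₁ := by
    obtain ⟨m, hm⟩ := hK₁ 1 le_rfl
    have h0 : 0 ≤ ∫ y in ball (0 : EuclideanSpace ℝ (Fin 3)) 1, (P y - m) ^ 2 := integral_nonneg fun y => sq_nonneg _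
    linarith
  set P' : EuclideanSpace ℝ (Fin 3) → ℝ := fun y => P y - mInf with hP'def
  have hP'c : Continuous P' := hPc.sub continuous_const
  have hP'1 : ContDiff ℝ 1 P' := (hP.sub contDiff_const).of_le (by norm_num)
  have hgrad' : ∀ y, gradient P' y = gradient P y := fun y => by
    simp only [hP'def, gradient, fderiv_sub_const]
  have heq' : ∀ y, -(ν • (Δ U) y) + a • U y + a • fderiv ℝ U y y + (B (U y) - fderiv ℝ U y (B y)) +
      convect U U y + gradient P' y = 0 := fun y => by rw [hgrad' y]; exact heq y
  have hNS := isClassicalNSSolutionOn_physicalField hν ha hU hP'1 hB hdiv heq' hu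
  have hp := fun (t : ℝ) (ht : t < 0) (x : EuclideanSpace ℝ (Fin 3)) => physicalPressure_apply (B := B) (P := P') ha ht x
  -- the gauged pressure flux for `P'`
  have hJ' : ∀ (z : EuclideanSpace ℝ (Fin 3)) (ρ : ℝ), 0 < ρ →
      ∃ m : ℝ, ∫ y in ball z ρ, |P' y - m| * ‖U y‖ ≤ J₀ * ρ ^ γ := by
    intro z ρ hρ
    obtain ⟨m, hm⟩ := hJ z ρ hρ
    refine ⟨m - mInf, ?_⟩
    have e : ∀ y, P' y - (m - mInf) = P y - m := fun y => by simp only [hP'def]; ring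
    simp_rw [e]
    exact hm
  -- the cylinder sits below the blow-up time
  have hQsub : ((parabolicCylinderOpens 1 ((0 : ℝ), (0 : EuclideanSpace ℝ (Fin 3))) :
      TopologicalSpace.Opens (ℝ × EuclideanSpace ℝ (Fin 3))) : Set (ℝ × EuclideanSpace ℝ (Fin 3))) ⊆
      Iio (0 : ℝ) ×ˢ (univ : Set (EuclideanSpace ℝ (Fin 3))) := by
    intro z hz
    rw [coe_parabolicCylinderOpens, mem_parabolicCylinder] at hz
    exact ⟨hz.1.2, mem_univ _⟩
  refine ⟨_, hNS.onRegion.isSuitableWeakSolutionOn_of_subset hν hQsub, ?_, ?_, ?_⟩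
  · -- `henergy`: `∫_{B₁} ‖u(t)‖² = λ⁻¹ ∫_{B(0,λ)} ‖U‖² ≤ K₃ + M²|B₁|`
    refine ⟨(K₃ + M ^ 2 * W).toNNReal, ae_of_all _ fun t ht => ?_⟩
    have ht0 : t < 0 := ht.2
    have ht' : t ∈ Iio (0 : ℝ) := ht0
    set lam : ℝ := (Real.sqrt (2 * a * (0 - t)))⁻¹ with hlam
    have hlam0 : 0 < lam := scale_pos ha ht0
    have hcont : Continuous fun x => ‖u t x‖ ^ 2 := (hNS.contDiff_velocity ht').continuous.norm.pow 2
    have e1 : ∫⁻ x in ball (0 : EuclideanSpace ℝ (Fin 3)) 1, ‖u t x‖ₑ ^ 2 =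
        ENNReal.ofReal (∫ x in ball (0 : EuclideanSpace ℝ (Fin 3)) 1, ‖u t x‖ ^ 2) := by
      have e : ∀ x, ‖u t x‖ₑ ^ 2 = ENNReal.ofReal (‖u t x‖ ^ 2) := fun x => by
        rw [← ofReal_norm, ENNReal.ofReal_pow (norm_nonneg _)]
      simp_rw [e]
      exact lintegral_ball_ofReal_eq hcont (fun x => by positivity) 0 1
    have e2 := setIntegral_ball_norm_sq_physicalField ha hB hu ht0 0 1
    rw [map_zero, smul_zero, one_mul, ← hlam] at e2
    have hcoe : ((K₃ + M ^ 2 * W).toNNReal : ℝ≥0∞) = ENNReal.ofReal (K₃ + M ^ 2 * W) := rfl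
    rw [e1, e2, hcoe]
    refine ENNReal.ofReal_le_ofReal ?_
    rcases le_or_gt 1 lam with h1 | h1
    · have h := hK₃ 0 lam h1
      calc lam⁻¹ * ∫ y in ball (0 : EuclideanSpace ℝ (Fin 3)) lam, ‖U y‖ ^ 2 ≤ lam⁻¹ * (K₃ * lam) :=
            mul_le_mul_of_nonneg_left h (inv_nonneg.2 hlam0.le)
        _ = K₃ := by field_simp
        _ ≤ K₃ + M ^ 2 * W := by nlinarith
    · have h := setIntegral_ball_norm_sq_le_cube (V := U) hM 0 hlam0
      rw [← hW] at h
      calc lam⁻¹ * ∫ y in ball (0 : EuclideanSpace ℝ (Fin 3)) lam, ‖U y‖ ^ 2 ≤ lam⁻¹ * (M ^ 2 * W * lam ^ 3) :=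
            mul_le_mul_of_nonneg_left h (inv_nonneg.2 hlam0.le)
        _ = M ^ 2 * W * lam ^ 2 := by field_simp
        _ ≤ M ^ 2 * W * 1 := mul_le_mul_of_nonneg_left (by nlinarith) (by positivity)
        _ ≤ K₃ + M ^ 2 * W := by linarith
  · -- `hgrad`: the classical gradient is a weak gradient; its `L²(Q₁)` norm is the dissipation
    refine ⟨fun t x => fderiv ℝ (u t) x,
      IsClassicalNSSolutionOnRegion.hasWeakSpatialGradientOn (isOpen_Iio.prod isOpen_univ) hNS.onRegion hQsub, ?_⟩
    obtain ⟨Cd, φ, hφ, hφc, hφ0, hφ1, hCd⟩ := dissipation_bound hν ha hB hu hNS hp hUc hM hγ2 hI hJ'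
    exact (lintegral_cylinder_gradient_le hNS hφ.continuous hφc hφ0 hφ1 hCd).trans_lt ENNReal.ofReal_lt_top
  · -- `hp`: Hölder on the balls `B(0,λ)` and the constant gauge
    set C₁ : ℝ := (52 * K₁) ^ (3 / 4 : ℝ) * W ^ (1 / 4 : ℝ) with hC₁
    have hC₁0 : 0 ≤ C₁ := by positivity
    have hbig : ∀ ρ : ℝ, 1 ≤ ρ → ∫⁻ y in ball (0 : EuclideanSpace ℝ (Fin 3)) ρ, ‖P' y‖ₑ ^ (3 / 2 : ℝ) ≤
        ENNReal.ofReal (C₁ * ρ ^ (3 / 2 : ℝ)) := fun ρ hρ =>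
      lintegral_ball_rpow_threeHalves_le hP'c (by linarith) (hmInf ρ hρ)
    have hsmall : ∀ ρ : ℝ, 0 < ρ → ρ < 1 → ∫⁻ y in ball (0 : EuclideanSpace ℝ (Fin 3)) ρ, ‖P' y‖ₑ ^ (3 / 2 : ℝ) ≤
        ENNReal.ofReal C₁ := fun ρ hρ hρ1 => by
      have h := hbig 1 le_rfl
      rw [Real.one_rpow, mul_one] at h
      exact (lintegral_mono_set (ball_subset_ball hρ1.le)).trans h
    exact (lintegral_cylinder_pressure_le ha hB hNS hp hP'c hC₁0 hbig hsmall).trans_lt ENNReal.ofReal_lt_top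


/-! ## §3 The linear-density half alone -/

open LocalEnergyRescue Literature.Analysis.FluidPDE in
/-- **S3a (i) alone**: a bounded smooth rotated profile with `BMO₂` pressure and sub-volume energy density `β > 1` has LINEAR
energy density `∫_{B(z,ρ)}‖U‖² ≤ K₃ρ` (`ρ ≥ 1`) — the first conjunct of `stub_localEnergyClass`, freed of the physical field
(the field hypothesis is instantiated with `rfl`). [cite: Tsai1998, Lemma 4.1 (p. 46)] -/
theorem linearDensity_of_bmo_subVolume :
    ∀ (ν a : ℝ), 0 < ν → 0 < a → ∀ (B : EuclideanSpace ℝ (Fin 3) →L[ℝ] EuclideanSpace ℝ (Fin 3))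
      (U : EuclideanSpace ℝ (Fin 3) → EuclideanSpace ℝ (Fin 3)) (P : EuclideanSpace ℝ (Fin 3) → ℝ),
      ContDiff ℝ (⊤ : ℕ∞) U → ContDiff ℝ 2 P → (∀ x, inner ℝ (B x) x = 0) →
      Literature.Analysis.FluidPDE.VectorCalculus.IsDivFree U →
      (∀ y, -(ν • Laplacian.laplacian U y) + a • U y + a • fderiv ℝ U y y
        + (B (U y) - fderiv ℝ U y (B y)) + Literature.Analysis.FluidPDE.convect U U y
        + gradient P y = 0) →
      (∃ M : ℝ, ∀ y, ‖U y‖ ≤ M) →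
      ∀ K : ℝ,
      (∀ (z : EuclideanSpace ℝ (Fin 3)) (ρ : ℝ), 0 < ρ →
        ∃ m : ℝ, ∫ y in Metric.ball z ρ, (P y - m) ^ 2 ≤ K * ρ ^ 3) →
      ∀ (β K₂ : ℝ), 1 < β →
      (∀ (z : EuclideanSpace ℝ (Fin 3)) (ρ : ℝ), 1 ≤ ρ →
        ∫ y in Metric.ball z ρ, ‖U y‖ ^ 2 ≤ K₂ * ρ ^ (3 - β)) →
      ∃ K₃ : ℝ, ∀ (z : EuclideanSpace ℝ (Fin 3)) (ρ : ℝ), 1 ≤ ρ →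
        ∫ y in Metric.ball z ρ, ‖U y‖ ^ 2 ≤ K₃ * ρ := by
  intro ν a hν ha B U P hU hP hB hdiv heq hbdd K hbmo β K₂ hβ hdens
  obtain ⟨⟨K₃, hK₃⟩, -⟩ := stub_localEnergyClass ν a hν ha B U P hU hP hB hdiv heq hbdd K hbmo β K₂ hβ hdens _
    (fun t x => rfl)
  refine ⟨K₃, fun z ρ hρ => ?_⟩
  have h := hK₃ z ρ hρ
  norm_num at h
  exact h

end Summit.NavierStokesRegularity.NavierStokesRegularity.Theorems.CoriolisHead

end
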